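import Literature.Computability.Complexity.Promise

/-!
# Textbook promise-BPP is closed under Karp reductions of promise problems (Goldreich 2006)

Named fact (D-0014) for route QuantumAdvantage/PromiseLift, crux #6
(`Summit.QuantumAdvantage.QuantumAdvantage.Theses.PromiseLift.PlPromiseBPPClosedUnderReductions`,
item `stmt-QuantumAdvantage-0472`), whose signature it records verbatim, and the generic
"completeness ⇒ (class ⊄ PromiseBPP' ↔ complete problem ∉ PromiseBPP')" corollary consumed by
cruxes #7/#8 (`PlXIffKForrelationNotPromiseBPP`, `PlXIffJonesNotPromiseBPP`).

**Source.** O. Goldreich, *On promise problems: a survey*, in: Shimon Even Festschrift, LNCS 3895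
(2006) 254–290, §1.2: Definition 2 (P, NP, BPP as classes of promise problems — the BPP bullet is
the tree's `PromiseBPP'`: acceptance probability `≥ 2/3` on YES-instances, rejection probability
`≥ 2/3` on NO-instances, nothing off the promise), Definition 3 (Karp- and Cook-reductions among
promise problems — the Karp bullet is the tree's `PromiseProblem.PolyTimeReducible`), and the
remark following Definition 3 (p. 258): "the standard meaning of a reduction is preserved: if `Π`
is Cook-reducible to a promise problem in `P` (or in `BPP`) then `Π` is in `P` (resp., in
`BPP`)."  A Karp reduction is a one-query Cook reduction, so in particular promise-BPP is closed
downwards under Karp reductions.  (Proof: compose the reduction `f ∈ FP` with the probabilistic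
decider; in the tree's random-string form take coins of length `p (|f x|) ≤ p' (|x|)` and use that
the uniform measure of an event depending only on a prefix is the prefix measure.  A tree proof
needs composition in `FP` — `PolyTimeComputable.comp`, a Mathlib `proof_wanted` — which is why the
sibling closures `mem_PromiseP_of_polyTimeReducible`, `mem_PromiseNP_of_polyTimeReducible`
(`Promise.lean`) are recorded as facts as well.)

## References
* O. Goldreich, On promise problems: a survey, LNCS 3895 (2006) 254–290, §1.2 Def. 2, Def. 3 and
  the remark on p. 258 [Goldreich2006].
-/

namespace Literature.Computability.Complexity

namespace PromiseProblem

/-- **Goldreich 2006, §1.2 (remark after Def. 3, p. 258), Karp case for promise-BPP:** textbook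
promise-BPP (`PromiseBPP'`) is closed downwards under polynomial-time Karp reductions of promise
problems: if `Q₁` Karp-reduces to `Q₂` and `Q₂ ∈ PromiseBPP'` then `Q₁ ∈ PromiseBPP'`.  Stated with
explicit binders, verbatim the signature of `stmt-QuantumAdvantage-0472`; grounds
`Summit.QuantumAdvantage.QuantumAdvantage.Theses.PromiseLift.PlPromiseBPPClosedUnderReductions`.
[cite: Goldreich2006, §1.2, Def. 3 and remark p. 258] -/
def mem_PromiseBPP'_of_polyTimeReducible : Prop :=
  ∀ Q₁ Q₂ : PromiseProblem, Q₁.PolyTimeReducible Q₂ → Q₂ ∈ PromiseBPP' → Q₁ ∈ PromiseBPP'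

/-! ### API -/

/-- If `R` is complete for a class `C` of promise problems under Karp reductions (`R ∈ C` and every
member of `C` reduces to `R`), then `C ⊄ PromiseBPP'` iff `R ∉ PromiseBPP'` — given the closure
fact.  This is the shape consumed by the PromiseLift cruxes #7/#8 with `C = PromiseBQP` and
`R = kForrelationProblem` / `jonesApproxProblem`. [Goldreich 2006, §1.3(3) and §4.1 (complete
promise problems)] [folklore] -/
theorem not_subset_PromiseBPP'_iff_of_complete (h : mem_PromiseBPP'_of_polyTimeReducible)
    {C : Set PromiseProblem} {R : PromiseProblem} (hmem : R ∈ C)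
    (hhard : ∀ Q ∈ C, Q.PolyTimeReducible R) :
    ¬ (C ⊆ PromiseBPP') ↔ R ∉ PromiseBPP' := by
  constructor
  · intro hC hR
    exact hC fun Q hQ => h Q R (hhard Q hQ) hR
  · intro hR hC
    exact hR (hC hmem)

/-- The closure fact in the implicit-binder shape of its `PromiseP`/`PromiseNP` siblings.
[Goldreich 2006, §1.2] [folklore] -/
theorem mem_PromiseBPP'_of_polyTimeReducible' (h : mem_PromiseBPP'_of_polyTimeReducible)
    {Q₁ Q₂ : PromiseProblem} (h₁₂ : Q₁.PolyTimeReducible Q₂) (h₂ : Q₂ ∈ PromiseBPP') :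
    Q₁ ∈ PromiseBPP' :=
  h Q₁ Q₂ h₁₂ h₂

end PromiseProblem

end Literature.Computability.Complexity
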